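import Summits.QuantumFields.QCD.Theses.QuarksNoInfraredClause
import Literature.MathematicalPhysics.QuantumFieldTheory.QCDFlavourSymmetry
import Literature.MathematicalPhysics.QuantumFieldTheory.QCDTimeReflection
import Summits.QuantumFields.QCD.Theorems.QuarksNoInfraredClauseTorusHalfSpectrumStubSelectionRule
import HarnessLib.Audit

/-!
# RESTATE-v2 — typed restatement candidates for the crux `TorusHalfSpectrum` (stmt-QuantumFields-9508)

Lead gen 1 / continuation c2 (`prover-line-stmt-QuantumFields-9508-c2-0`, 2026-08-17).  Evidence file (rc 0,
0 sorries): nothing here is a stub of the line; it is the material the tenure planner needs to RESTATE the crux,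
with every implication between the candidates and the filed crux kernel-checked.

Three leads (gen 0, gen 1/c1, gen 1/c2) agree that the crux AS FILED cannot be proved by any known mechanism:

* (a) **common threshold** (gen 0, c1): the hypothesis is per pair, `∀ pairs, ∃ C, ∀ᶠ k` — nothing is uniform over
  pairs, and the Haag composites `A · τ_x ΘB` are infinitely many pairs.  Baire + bilinearity uniformise threshold
  and constant inside every FIXED (box, link-support) Banach class (this lead), but the composites leave every
  class as `|x| → ∞`.  Repair: `UniformNeutralGap` (`∃ k₀, ∀ pairs, ∃ C, ∀ k ≥ k₀`) in the hypothesis — §1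
  (`TorusHalfSpectrumRepaired`, c1's RESTATE, recapitulated; `repaired_of_filed`).
* (b) **torus return** (this lead): on the statement's symmetric tori `(2S+1)⁴` with the time-PERIODIC Wilson
  quarks of `qcdTorusExpect` (the `(−1)^F`-TWISTED trace `Str 𝕋^{2S+1−n} Â 𝕋ⁿ B̂ / Str 𝕋^{2S+1}`) a proof of the
  light core needs, besides the operator-level trace formula with quark insertions, a RETURN from the
  reflection-positive thermal family (`qcdTorusExpectAP`, the honest trace, site-RP PROVED:
  `WilsonQCDSiteReflectionPositivityAP_holds`) whose price is a low-temperature pressure bound / the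
  non-vanishing and `Tr`-comparability of `Str 𝕋^{2S+1}` — NOT among the crux's hypotheses and not derivable
  from neutral clustering.  The sister crux stmt-QuantumFields-9737 (`StableActionBridge`, line
  `twisted_trace_transfer`) types exactly this (`LowTemperaturePressureAt`, `CorrelatorReturn`,
  `hasLatticeMassGap_of_comparison`).  §3 gives the second candidate `TorusHalfSpectrumThermalReturn`
  (common threshold + a COMMON-threshold correlator return as hypotheses) and the kernel-checked reduction
  `thermalReturn_reduces : ThermalHalfSpectrum → TorusHalfSpectrumThermalReturn`: under the return, HALF on the
  statement's tori follows from HALF on the thermal family (`ThermalHalfSpectrum`, Haag's additivity on Lüscher's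
  positive transfer matrix — the principled open core, where one-point functions and OS-norms ARE bounded by
  operator norms).
* (c) **a necessary condition invisible to the hypothesis** (this lead, §2): the conclusion at `n = 0` forces,
  for every conjugate charged pair, eventual boundedness UNIFORMLY IN `S ≥ L_k` of the ONE-POINT function
  `⟨A(0)·B(0)⟩_{k,S}` of the neutral product (`onePoint_bounded_of_pairClusters`); the hypothesis controls only
  CONNECTED neutral two-point functions, and with a signed Wilson determinant in the light window nothing bounds
  `⟨N⟩_P = Str(𝕋^{2S+1} N̂)/Str 𝕋^{2S+1}` a priori (on the thermal family `⟨N⟩_th ≤ ‖N̂‖`).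

Recommendation (PROMOTE-v2.md): restate with (a) and either move HALF to the thermal family
(`ThermalHalfSpectrum` + the sister's return as a shared support item) or take the common-threshold return as an
explicit hypothesis (`TorusHalfSpectrumThermalReturn`); `ThinQCD`'s neutral clause must then be strengthened to
the same common-threshold (and, for the return, pressure) form, which an honest construction delivers anyway.
-/

noncomputable section

namespace Summit.QuantumFields.QCD.Cruxes.TorusHalfSpectrum.RestateV2

open scoped BigOperators
open Filter
open Literature.MathematicalPhysics.QuantumFieldTheory
open Summit.QuantumFields.QCD.Theses.QuarksNoInfraredClause (TorusHalfSpectrum)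

variable {Nf : ℕ}

/-! ## §1  Candidate R1 — the common threshold (c1's RESTATE, recapitulated) -/

/-- **Common-threshold neutral lattice gap at rate `Δ'` from step `k₀` on** (statement's twisted functional). -/
def UniformNeutralGapFrom (sch : QCDScheme Nf) (Δ' : ℝ) (k₀ : ℕ) : Prop :=
  ∀ (R R' : ℕ) (A : QCDLatticeObservable Nf R) (B : QCDLatticeObservable Nf R'),
    A.IsFlavourNeutral → B.IsFlavourNeutral → ∃ C : ℝ, ∀ k : ℕ, k₀ ≤ k →
      ∀ S : ℕ, sch.L k ≤ S → ∀ n : ℕ, n ≤ S →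
        ‖qcdLatticeConnectedCorr (sch.β k) (2 * S + 1) (fun fl => sch.mq fl k) A B n‖ ≤
          C * Real.exp (-(Δ' * (sch.a k * n)))

/-- **Common-threshold neutral lattice gap at rate `Δ'`** (`∃ k₀`). -/
def UniformNeutralGap (sch : QCDScheme Nf) (Δ' : ℝ) : Prop :=
  ∃ k₀ : ℕ, UniformNeutralGapFrom sch Δ' k₀

/-- **Candidate R1 — `TorusHalfSpectrumRepaired`**: the filed crux with the per-pair neutral hypothesis replaced by
the common-threshold one, everything else verbatim.  Closed modulo the light core alone by the registered skeleton
(`Lines/birth.lean` §5, `torusHalfSpectrumRepaired_of_lightCore`). -/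
def TorusHalfSpectrumRepaired : Prop :=
  ∀ (Nf : ℕ) (sch : QCDScheme Nf) (Δ : ℝ), 0 < Δ → 0 < betaCoeff₀ Nf → sch.HasAsymptoticScaling →
    (∀ fl : Fin Nf, ∀ᶠ k in atTop, -1 < sch.mq fl k) → UniformNeutralGap sch (2 * Δ) →
      sch.HasLatticeMassGap Δ

/-- A common threshold is in particular a per-pair threshold. -/
theorem hasNeutralLatticeMassGap_of_uniform {sch : QCDScheme Nf} {Δ' : ℝ}
    (h : UniformNeutralGap sch Δ') : sch.HasNeutralLatticeMassGap Δ' := by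
  obtain ⟨k₀, hk₀⟩ := h
  intro R R' A B hA hB
  obtain ⟨C, hC⟩ := hk₀ R R' A B hA hB
  exact ⟨C, eventually_atTop.2 ⟨k₀, fun k hk => hC k hk⟩⟩

/-- **The filed crux implies R1** (the repair only strengthens the hypothesis). -/
theorem repaired_of_filed (h : TorusHalfSpectrum) : TorusHalfSpectrumRepaired :=
  fun Nf sch Δ hΔ hb hAS hbranch hU =>
    h Nf sch Δ hΔ hb hAS hbranch (hasNeutralLatticeMassGap_of_uniform hU)

/-! ## §2  The necessary one-point condition hidden in the conclusion -/

/-- **Rate-`Δ` clustering of one pair** (verbatim the body of `HasLatticeMassGap`). -/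
def PairClusters {R R' : ℕ} (sch : QCDScheme Nf) (Δ : ℝ)
    (A : QCDLatticeObservable Nf R) (B : QCDLatticeObservable Nf R') : Prop :=
  ∃ C : ℝ, ∀ᶠ k in atTop, ∀ S : ℕ, sch.L k ≤ S → ∀ n : ℕ, n ≤ S →
    ‖qcdLatticeConnectedCorr (sch.β k) (2 * S + 1) (fun fl => sch.mq fl k) A B n‖ ≤
      C * Real.exp (-(Δ * (sch.a k * n)))

/-- **At `n = 0` the connected correlation of a CONJUGATE CHARGED pair is the one-point function of the product**:
for `A` homogeneous of charge `q ≠ 0` and any `B`, `⟨A⟩ = 0` by the exact selection rule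
(`Birth.SelectionRule.qcdTorusExpect_onTorus_eq_zero`), so `corr(0) = ⟨A(0)·B(0)⟩`. -/
theorem conn_zero_eq_onePoint {R R' : ℕ} (A : QCDLatticeObservable Nf R) (B : QCDLatticeObservable Nf R')
    {q : Fin Nf → ℤ} (hq : q ≠ 0)
    (hA : ∀ t : Fin Nf → ℂ, (∀ f, t f ≠ 0) → ∀ U,
      QCDLatticeObservable.flavourScale t (A.F U) = (∏ f, t f ^ (q f)) • A.F U)
    (β : ℝ) (S : ℕ) [NeZero S] (mq : Fin Nf → ℝ) :
    qcdLatticeConnectedCorr β S mq A B 0 =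
      qcdTorusExpect β S mq (fun U => A.onTorus S 0 U * B.onTorus S (Pi.single 0 ((0 : ℕ) : ℤ)) U) := by
  rw [qcdLatticeConnectedCorr, Birth.SelectionRule.qcdTorusExpect_onTorus_eq_zero A hq hA, zero_mul, sub_zero]

/-- **The necessary condition.**  If a conjugate charged pair clusters at ANY rate in the shape of
`HasLatticeMassGap`, then the one-point function of the neutral product `⟨A(0)·B(0)⟩_{k,S}` is eventually bounded,
UNIFORMLY in the torus size `S ≥ L_k`.  The crux's hypothesis (connected neutral two-point functions only) says
nothing about one-point functions of neutral observables; any proof must produce this bound from elsewhere (operator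
norms on the thermal family + the return). -/
theorem onePoint_bounded_of_pairClusters {R R' : ℕ} {sch : QCDScheme Nf} {Δ : ℝ}
    {A : QCDLatticeObservable Nf R} {B : QCDLatticeObservable Nf R'} {q : Fin Nf → ℤ} (hq : q ≠ 0)
    (hA : ∀ t : Fin Nf → ℂ, (∀ f, t f ≠ 0) → ∀ U,
      QCDLatticeObservable.flavourScale t (A.F U) = (∏ f, t f ^ (q f)) • A.F U)
    (h : PairClusters sch Δ A B) :
    ∃ C : ℝ, ∀ᶠ k in atTop, ∀ S : ℕ, sch.L k ≤ S →
      ‖qcdTorusExpect (sch.β k) (2 * S + 1) (fun fl => sch.mq fl k)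
          (fun U => A.onTorus (2 * S + 1) 0 U * B.onTorus (2 * S + 1) (Pi.single 0 ((0 : ℕ) : ℤ)) U)‖ ≤ C := by
  obtain ⟨C, hC⟩ := h
  refine ⟨C, ?_⟩
  filter_upwards [hC] with k hk S hS
  have h0 := hk S hS 0 (Nat.zero_le S)
  rw [conn_zero_eq_onePoint A B hq hA] at h0
  simpa using h0

/-- In particular the FILED crux (indeed `HasLatticeMassGap Δ` alone) forces these one-point bounds for every
conjugate charged pair `(q, −q)`, `q ≠ 0`. -/
theorem onePoint_bounded_of_hasLatticeMassGap {sch : QCDScheme Nf} {Δ : ℝ} (h : sch.HasLatticeMassGap Δ)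
    {R R' : ℕ} (A : QCDLatticeObservable Nf R) (B : QCDLatticeObservable Nf R') {q : Fin Nf → ℤ} (hq : q ≠ 0)
    (hA : ∀ t : Fin Nf → ℂ, (∀ f, t f ≠ 0) → ∀ U,
      QCDLatticeObservable.flavourScale t (A.F U) = (∏ f, t f ^ (q f)) • A.F U) :
    ∃ C : ℝ, ∀ᶠ k in atTop, ∀ S : ℕ, sch.L k ≤ S →
      ‖qcdTorusExpect (sch.β k) (2 * S + 1) (fun fl => sch.mq fl k)
          (fun U => A.onTorus (2 * S + 1) 0 U * B.onTorus (2 * S + 1) (Pi.single 0 ((0 : ℕ) : ℤ)) U)‖ ≤ C :=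
  onePoint_bounded_of_pairClusters hq hA (h R R' A B)

/-! ## §3  Candidate R2 — the thermal family and the return (typed interface to crux 9737) -/

/-- **Thermal connected Euclidean-time correlation** `⟨A(0)·B(n e₀)⟩_th − ⟨A⟩_th⟨B⟩_th`: the tree's
`qcdLatticeConnectedCorr` with the time-ANTIPERIODIC functional `qcdTorusExpectAP` (the honest trace
`Tr 𝕋^{2S+1−n} Â 𝕋ⁿ B̂ / Tr 𝕋^{2S+1}`, reflection positive: `WilsonQCDSiteReflectionPositivityAP_holds`).  Same body as
`…Cruxes.StableActionBridge.TwistedTraceTransfer.qcdLatticeConnectedCorrThermal` (sister crux 9737). -/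
def qcdLatticeConnectedCorrThermal {R R' : ℕ} (β : ℝ) (S : ℕ) [NeZero S] (mq : Fin Nf → ℝ)
    (A : QCDLatticeObservable Nf R) (B : QCDLatticeObservable Nf R') (n : ℕ) : ℂ :=
  qcdTorusExpectAP β S mq (fun U => A.onTorus S 0 U * B.onTorus S (Pi.single 0 (n : ℤ)) U) -
    qcdTorusExpectAP β S mq (A.onTorus S 0) * qcdTorusExpectAP β S mq (B.onTorus S (Pi.single 0 (n : ℤ)))

/-- **Uniform THERMAL lattice mass gap `Δ`** (all pairs, per-pair constant and threshold; same body as the sister's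
`HasThermalLatticeMassGap`). -/
def HasThermalLatticeMassGap (sch : QCDScheme Nf) (Δ : ℝ) : Prop :=
  ∀ (R R' : ℕ) (A : QCDLatticeObservable Nf R) (B : QCDLatticeObservable Nf R'), ∃ C : ℝ,
    ∀ᶠ k in atTop, ∀ S : ℕ, sch.L k ≤ S → ∀ n : ℕ, n ≤ S →
      ‖qcdLatticeConnectedCorrThermal (sch.β k) (2 * S + 1) (fun fl => sch.mq fl k) A B n‖ ≤
        C * Real.exp (-(Δ * (sch.a k * n)))

/-- **Common-threshold neutral THERMAL gap at rate `Δ'`.** -/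
def UniformNeutralGapThermal (sch : QCDScheme Nf) (Δ' : ℝ) : Prop :=
  ∃ k₀ : ℕ, ∀ (R R' : ℕ) (A : QCDLatticeObservable Nf R) (B : QCDLatticeObservable Nf R'),
    A.IsFlavourNeutral → B.IsFlavourNeutral → ∃ C : ℝ, ∀ k : ℕ, k₀ ≤ k →
      ∀ S : ℕ, sch.L k ≤ S → ∀ n : ℕ, n ≤ S →
        ‖qcdLatticeConnectedCorrThermal (sch.β k) (2 * S + 1) (fun fl => sch.mq fl k) A B n‖ ≤
          C * Real.exp (-(Δ' * (sch.a k * n)))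

/-- **Common-threshold correlator return at rate `Δth`**: ONE step `k₁` beyond which, for every pair (constant per
pair), the twisted and thermal connected correlations differ by at most `C e^{−Δth a_k (2S+1−n)}` on all tori
`S ≥ L_k`, `n ≤ S` (the defect decays in the complementary arc).  The sister's `CorrelatorReturn` (crux 9737, stub 3)
concludes the per-pair form `∀ pairs, ∃ C, ∀ᶠ k` from `IsEventuallyPhysical` + `LowTemperaturePressureAt sch Δth`; the
common threshold is what its proof route gives anyway (the threshold is that of the pressure clause; the finitely
many small tori `L_k ≤ S < R + R'` are absorbed in the constant). -/
def UniformCorrelatorReturnAt (sch : QCDScheme Nf) (Δth : ℝ) : Prop :=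
  ∃ k₁ : ℕ, ∀ (R R' : ℕ) (A : QCDLatticeObservable Nf R) (B : QCDLatticeObservable Nf R'), ∃ C : ℝ,
    ∀ k : ℕ, k₁ ≤ k → ∀ S : ℕ, sch.L k ≤ S → ∀ n : ℕ, n ≤ S →
      ‖qcdLatticeConnectedCorr (sch.β k) (2 * S + 1) (fun fl => sch.mq fl k) A B n -
          qcdLatticeConnectedCorrThermal (sch.β k) (2 * S + 1) (fun fl => sch.mq fl k) A B n‖ ≤
        C * Real.exp (-(Δth * (sch.a k * (2 * S + 1 - n))))

/-- **HALF on the thermal family** (the principled open core): along an asymptotically scaling scheme on the physical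
branch, the common-threshold neutral THERMAL gap at `2Δ` forces the thermal gap `Δ` for ALL pairs — Haag's additivity
of the spectrum on Lüscher's positive transfer matrix (`Tr`, not `Str`: reflection positivity, spectral theorem,
Källén–Lehmann, operator-norm bounds on one-point functions are all available here). [difficulty: XL/open bookkeeping] -/
def ThermalHalfSpectrum : Prop :=
  ∀ (Nf : ℕ) (sch : QCDScheme Nf) (Δ : ℝ), 0 < Δ → 0 < betaCoeff₀ Nf → sch.HasAsymptoticScaling →
    (∀ fl : Fin Nf, ∀ᶠ k in atTop, -1 < sch.mq fl k) → UniformNeutralGapThermal sch (2 * Δ) →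
      HasThermalLatticeMassGap sch Δ

/-- **Candidate R2 — `TorusHalfSpectrumThermalReturn`**: the filed crux with (a) the common-threshold neutral
hypothesis and (b) the common-threshold correlator return at rate `2Δ` as an explicit hypothesis (to be discharged,
for the route's witness, by crux 9737's `CorrelatorReturn` from the construction's pressure bound). -/
def TorusHalfSpectrumThermalReturn : Prop :=
  ∀ (Nf : ℕ) (sch : QCDScheme Nf) (Δ : ℝ), 0 < Δ → 0 < betaCoeff₀ Nf → sch.HasAsymptoticScaling →
    (∀ fl : Fin Nf, ∀ᶠ k in atTop, -1 < sch.mq fl k) → UniformNeutralGap sch (2 * Δ) →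
      UniformCorrelatorReturnAt sch (2 * Δ) → sch.HasLatticeMassGap Δ

/-- Elementary: for `n ≤ S`, `0 ≤ a` and `0 ≤ Δ ≤ Δth / 2`... in the form used twice below: the complementary-arc
exponential at rate `2Δ` is below the direct one at rate `2Δ` (`2S+1−n ≥ n`). -/
theorem exp_arc_le {Δ' a : ℝ} (hΔ : 0 ≤ Δ') (ha : 0 ≤ a) {n S : ℕ} (hn : n ≤ S) :
    Real.exp (-(Δ' * (a * (2 * S + 1 - n)))) ≤ Real.exp (-(Δ' * (a * n))) := by
  apply Real.exp_le_exp.2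
  have hn' : (n : ℝ) ≤ S := by exact_mod_cast hn
  have h3 : (n : ℝ) ≤ 2 * S + 1 - n := by linarith
  have := mul_le_mul_of_nonneg_left (mul_le_mul_of_nonneg_left h3 ha) hΔ
  linarith

/-- A weaker rate costs nothing: `e^{−Δ x} ≤ e^{−Δ' x}` for `Δ' ≤ Δ`, `x ≥ 0`. -/
theorem exp_neg_mul_le_of_le {Δ Δ' a x : ℝ} (ha : 0 ≤ a) (hx : 0 ≤ x) (hle : Δ' ≤ Δ) :
    Real.exp (-(Δ * (a * x))) ≤ Real.exp (-(Δ' * (a * x))) :=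
  Real.exp_le_exp.2 (by nlinarith [mul_nonneg ha hx])

/-- **Step 1 of the reduction — the neutral hypothesis crosses to the thermal family**: common-threshold twisted
neutral gap at `2Δ` + common-threshold return at `2Δ` ⇒ common-threshold THERMAL neutral gap at `2Δ`
(`th = P − (P − th)`, `e^{−2Δ a (2S+1−n)} ≤ e^{−2Δ a n}`). -/
theorem uniformNeutralGapThermal_of_return {sch : QCDScheme Nf} {Δ : ℝ} (hΔ : 0 < Δ)
    (hU : UniformNeutralGap sch (2 * Δ)) (hR : UniformCorrelatorReturnAt sch (2 * Δ)) :
    UniformNeutralGapThermal sch (2 * Δ) := by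
  obtain ⟨k₀, hk₀⟩ := hU
  obtain ⟨k₁, hk₁⟩ := hR
  refine ⟨max k₀ k₁, fun R R' A B hA hB => ?_⟩
  obtain ⟨C₁, h₁⟩ := hk₀ R R' A B hA hB
  obtain ⟨C₂, h₂⟩ := hk₁ R R' A B
  refine ⟨max C₁ 0 + max C₂ 0, fun k hk S hS n hn => ?_⟩
  have ha : 0 ≤ sch.a k := (sch.a_pos k).le
  have hb₁ := h₁ k (le_of_max_le_left hk) S hS n hn
  have hb₂ := h₂ k (le_of_max_le_right hk) S hS n hn
  set P := qcdLatticeConnectedCorr (sch.β k) (2 * S + 1) (fun fl => sch.mq fl k) A B n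
  set Q := qcdLatticeConnectedCorrThermal (sch.β k) (2 * S + 1) (fun fl => sch.mq fl k) A B n
  have htri : ‖Q‖ ≤ ‖P‖ + ‖P - Q‖ := by
    calc ‖Q‖ = ‖P - (P - Q)‖ := by rw [sub_sub_cancel]
      _ ≤ ‖P‖ + ‖P - Q‖ := norm_sub_le _ _
  have he₂ : Real.exp (-(2 * Δ * (sch.a k * (2 * S + 1 - n)))) ≤ Real.exp (-(2 * Δ * (sch.a k * n))) :=
    exp_arc_le (by linarith) ha hn
  have hp : ‖P‖ ≤ max C₁ 0 * Real.exp (-(2 * Δ * (sch.a k * n))) :=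
    hb₁.trans (mul_le_mul_of_nonneg_right (le_max_left _ _) (Real.exp_pos _).le)
  have hpq : ‖P - Q‖ ≤ max C₂ 0 * Real.exp (-(2 * Δ * (sch.a k * n))) :=
    hb₂.trans ((mul_le_mul_of_nonneg_right (le_max_left _ _) (Real.exp_pos _).le).trans
      (mul_le_mul_of_nonneg_left he₂ (le_max_right _ _)))
  calc ‖Q‖ ≤ ‖P‖ + ‖P - Q‖ := htri
    _ ≤ _ := add_le_add hp hpq
    _ = (max C₁ 0 + max C₂ 0) * Real.exp (-(2 * Δ * (sch.a k * n))) := by ring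

/-- **Step 2 of the reduction — the conclusion returns**: thermal gap `Δ` + (per-pair use of the) return at `2Δ` ⇒
the statement's `HasLatticeMassGap Δ` (`P = th + (P − th)`, `e^{−2Δ a(2S+1−n)} ≤ e^{−2Δ a n} ≤ e^{−Δ a n}`).  This is
`hasLatticeMassGap_of_comparison` of the sister skeleton at `Δth = 2Δ`, `min Δ (2Δ) = Δ`. -/
theorem hasLatticeMassGap_of_return {sch : QCDScheme Nf} {Δ : ℝ} (hΔ : 0 < Δ)
    (hgap : HasThermalLatticeMassGap sch Δ) (hR : UniformCorrelatorReturnAt sch (2 * Δ)) :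
    sch.HasLatticeMassGap Δ := by
  obtain ⟨k₁, hk₁⟩ := hR
  intro R R' A B
  obtain ⟨C₁, h₁⟩ := hgap R R' A B
  obtain ⟨C₂, h₂⟩ := hk₁ R R' A B
  refine ⟨max C₁ 0 + max C₂ 0, ?_⟩
  filter_upwards [h₁, eventually_ge_atTop k₁] with k hk₁' hk S hS n hn
  have ha : 0 ≤ sch.a k := (sch.a_pos k).le
  have hb₁ := hk₁' S hS n hn
  have hb₂ := h₂ k hk S hS n hn
  set P := qcdLatticeConnectedCorr (sch.β k) (2 * S + 1) (fun fl => sch.mq fl k) A B n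
  set Q := qcdLatticeConnectedCorrThermal (sch.β k) (2 * S + 1) (fun fl => sch.mq fl k) A B n
  have htri : ‖P‖ ≤ ‖Q‖ + ‖P - Q‖ := by
    calc ‖P‖ = ‖Q + (P - Q)‖ := by rw [add_sub_cancel]
      _ ≤ ‖Q‖ + ‖P - Q‖ := norm_add_le _ _
  have he₂ : Real.exp (-(2 * Δ * (sch.a k * (2 * S + 1 - n)))) ≤ Real.exp (-(Δ * (sch.a k * n))) :=
    (exp_arc_le (by linarith) ha hn).trans (exp_neg_mul_le_of_le ha (Nat.cast_nonneg n) (by linarith))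
  have hq : ‖Q‖ ≤ max C₁ 0 * Real.exp (-(Δ * (sch.a k * n))) :=
    hb₁.trans (mul_le_mul_of_nonneg_right (le_max_left _ _) (Real.exp_pos _).le)
  have hpq : ‖P - Q‖ ≤ max C₂ 0 * Real.exp (-(Δ * (sch.a k * n))) :=
    hb₂.trans ((mul_le_mul_of_nonneg_right (le_max_left _ _) (Real.exp_pos _).le).trans
      (mul_le_mul_of_nonneg_left he₂ (le_max_right _ _)))
  calc ‖P‖ ≤ ‖Q‖ + ‖P - Q‖ := htri
    _ ≤ _ := add_le_add hq hpq
    _ = (max C₁ 0 + max C₂ 0) * Real.exp (-(Δ * (sch.a k * n))) := by ring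

/-- **The reduction: HALF on the thermal family implies candidate R2** (kernel-checked).  Under the common-threshold
return at `2Δ`, the twisted neutral hypothesis becomes a thermal neutral hypothesis (step 1), `ThermalHalfSpectrum`
gives the thermal all-pair gap `Δ`, and the conclusion returns (step 2). -/
theorem thermalReturn_reduces (h : ThermalHalfSpectrum) : TorusHalfSpectrumThermalReturn := by
  intro Nf sch Δ hΔ hb hAS hbranch hU hR
  exact hasLatticeMassGap_of_return hΔ
    (h Nf sch Δ hΔ hb hAS hbranch (uniformNeutralGapThermal_of_return hΔ hU hR)) hR

/-- **R1 implies R2** (R2 only adds a hypothesis). -/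
theorem thermalReturn_of_repaired (h : TorusHalfSpectrumRepaired) : TorusHalfSpectrumThermalReturn :=
  fun Nf sch Δ hΔ hb hAS hbranch hU _ => h Nf sch Δ hΔ hb hAS hbranch hU

/-- **The filed crux implies R2.** -/
theorem thermalReturn_of_filed (h : TorusHalfSpectrum) : TorusHalfSpectrumThermalReturn :=
  thermalReturn_of_repaired (repaired_of_filed h)

end Summit.QuantumFields.QCD.Cruxes.TorusHalfSpectrum.RestateV2

end
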